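import Summits.CriticalPhenomena.PercolationContinuityZ3.Theorems.SahiMasterFamilyTerminal
import Summits.CriticalPhenomena.PercolationContinuityZ3.Theorems.SahiMasterFamilyResidualThree
import Summits.CriticalPhenomena.PercolationContinuityZ3.Theorems.PercNearOneGluingNoHeavyLowerTailSahiCombTriangleThinEdgeHolds

/-!
# Terminal triples have `E_3 > 0` somewhere: the terminal class of (P3+)

Unit `prim-masterthm-p4` (gen 11; crux anchor stmt-CriticalPhenomena-4575, helper work; memo
`run/shared/lean/prim/prim-masterthm/prim-masterthm-p4/FACE-QUOTIENT-3.md`).  prim-master-conj's `SahiMasterFamilyTerminal` shows that a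
TERMINAL triple of increasing events (pairwise dependent, no common pivotal coordinate, all minors in `Z_3`) has `E_3 ≢ 0`, by proving
internally that it is either THE TRIANGLE `{e∨s, e∨t, s∨t}` or has a PURE event (a cylinder).  Both alternatives lie in proved
positivity strata of the tree:
* a cylinder member — Sahi/Blinovsky's principal stratum (`sahiE_three_ind_nonneg_of_principal`), so `E_3 ≥ 0` everywhere and
  `≠ 0` at every interior point (`sahiE_three_ne_zero_of_cylinder`): `sahiE_three_pos_of_cylinder`;
* the triangle — a thin-edge class-T triple, prim-masterthm-p5's unconditional stratum `SahiHybrid.sahiE_three_nonneg_thinEdge'`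
  (no coordinate in all three supports, `|esupp U_0 ∩ esupp U_1| ≤ 1`), so `E_3 ≥ 0` everywhere and `≠ 0` somewhere
  (`sahiE_three_ne_zero_of_triangle`): `sahiE_three_pos_of_triangle`.
Re-running the tree's case analysis with these endings (`terminal_core_pos`, a verbatim copy of `terminal_core` with the two terminal
calls replaced) gives **`exists_sahiE_three_pos_of_terminal`**: every terminal triple has `E_3(μ_p) > 0` at some interior `p` — the
terminal half of the reduction of (P3+) `SahiE3PositiveSomewhere` (`SahiMasterFamilyPositiveSomewhereReduction`).  HONEST FRAMING:
(P3+) itself, Sahi `C_k` / Kahn's Conjecture 5 and the master theorem remain OPEN. [this work]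
-/

noncomputable section

open scoped Classical

namespace Summit.CriticalPhenomena.PercolationContinuityZ3.Theorems

open Finset Function
open Literature.Combinatorics.Sahi2008
open Literature.Probability.Percolation (DeterminedBy determinedBy_iff)
open Literature.Probability.Percolation.DecisionTree (ind ind_of_mem ind_of_not_mem ind_nonneg)
open Literature.Probability.LatticeModels.Kahn2022 (Affects)

variable {ι : Type*} [Fintype ι]

/-! ### The two endings, with the sign -/

/-- **Pairwise-dependent triples with a cylinder slot have `E_3(μ_p) > 0` at every interior `p`**: `≥ 0` by the principal stratum
(Sahi's Theorem 2 / Blinovsky), `≠ 0` by the tree's `sahiE_three_ne_zero_of_cylinder`. [this work] -/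
theorem sahiE_three_pos_of_cylinder {ι : Type} [Fintype ι] {U : Fin 3 → Set (Set ι)} (hU : ∀ j, IsUpperSet (U j))
    (hpair : ∀ a b : Fin 3, a ≠ b → (esupp (U a) ∩ esupp (U b)).Nonempty) (j : Fin 3) (S : Set ι)
    (hS : U j = {ω | S ⊆ ω}) (p : ι → unitInterval) (hp : ∀ e, (p e : ℝ) ∈ Set.Ioo (0 : ℝ) 1) :
    0 < sahiE (bernoulliWeight p) 3 (fun i => ind (U i)) :=
  lt_of_le_of_ne (sahiE_three_ind_nonneg_of_principal p U hU j S hS) (sahiE_three_ne_zero_of_cylinder hU hpair j S hS p hp).symm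

/-- **The triangle has `E_3 > 0` somewhere**: if every event is `{x ∨ y}` with essential support `{x, y}`, the supports pairwise intersect
and no coordinate lies in all three supports, then some interior `p` has `E_3(μ_p) > 0` — `≠ 0` by top Möbius coefficients
(`sahiE_three_ne_zero_of_triangle`), `≥ 0` because such a triple is a thin-edge class-T triple (two distinct 2-element supports meet in at
most one point) and prim-masterthm-p5's `SahiHybrid.sahiE_three_nonneg_thinEdge'` applies. [this work] -/
theorem sahiE_three_pos_of_triangle {ι : Type} [Fintype ι] {U : Fin 3 → Set (Set ι)} (hU : ∀ j, IsUpperSet (U j))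
    (hpair : ∀ a b : Fin 3, a ≠ b → (esupp (U a) ∩ esupp (U b)).Nonempty)
    (hT : SahiHybrid.IsClassT fun i => esupp (U i))
    (htri : ∀ j, ∃ x y : ι, x ≠ y ∧ U j = orPair x y ∧ esupp (U j) = {x, y}) :
    ∃ p : ι → unitInterval, (∀ e, (p e : ℝ) ∈ Set.Ioo (0 : ℝ) 1) ∧
      0 < sahiE (bernoulliWeight p) 3 (fun j => ind (U j)) := by
  obtain ⟨p, hp, hne⟩ := sahiE_three_ne_zero_of_triangle hU hpair htri
  -- thin edge: `esupp (U 0) ∩ esupp (U 1)` has at most one element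
  have hthin : (esupp (U 0) ∩ esupp (U 1)).card ≤ 1 := by
    by_contra hlt
    push Not at hlt
    obtain ⟨x, y, hxy, -, h0⟩ := htri 0
    have hcard0 : (esupp (U 0)).card = 2 := by rw [h0]; exact card_pair hxy
    have hsub : esupp (U 0) ∩ esupp (U 1) = esupp (U 0) :=
      eq_of_subset_of_card_le inter_subset_left (by rw [hcard0]; omega)
    have h01 : esupp (U 0) ⊆ esupp (U 1) := by rw [← hsub]; exact inter_subset_right
    obtain ⟨e, he⟩ := hpair 0 2 (by decide)
    exact hT e ⟨(mem_inter.1 he).1, h01 (mem_inter.1 he).1, (mem_inter.1 he).2⟩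
  exact ⟨p, hp, lt_of_le_of_ne (SahiHybrid.sahiE_three_nonneg_thinEdge' U hU hT hthin p) hne.symm⟩

/-! ### The core: terminal triples have `E_3 > 0` somewhere -/

/-- **Terminal triples have `E_3(μ_p) > 0` for some interior `p`** (hypotheses in explicit form for the ordered triple `(A, B, C)`;
the tree's `terminal_core` with a positive conclusion: the triangle is a thin-edge class-T triple — P5's unconditional stratum — and a
pure event is a cylinder — Sahi/Blinovsky's principal stratum). [this work] -/
theorem terminal_core_pos {ι : Type} [Fintype ι] {A B C : Set (Set ι)}
    (hA : IsUpperSet A) (hB : IsUpperSet B) (hC : IsUpperSet C)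
    (hAB : (esupp A ∩ esupp B).Nonempty) (hAC : (esupp A ∩ esupp C).Nonempty) (hBC : (esupp B ∩ esupp C).Nonempty)
    (hprivA : esupp A ⊆ esupp B ∪ esupp C) (hprivB : esupp B ⊆ esupp A ∪ esupp C)
    (hprivC : esupp C ⊆ esupp A ∪ esupp B) (hcommon : ∀ i, i ∈ esupp A → i ∈ esupp B → i ∉ esupp C)
    (hmin : ∀ i ∈ esupp A ∪ esupp B ∪ esupp C, ∀ b : Bool, SuppZeroFlag 3 ![secAt i b A, secAt i b B, secAt i b C]) :
    ∃ p : ι → unitInterval, (∀ e, (p e : ℝ) ∈ Set.Ioo (0 : ℝ) 1) ∧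
      0 < sahiE (bernoulliWeight p) 3 (fun j => ind ((![A, B, C] : Fin 3 → Set (Set ι)) j)) := by
  -- basic facts
  have hU : ∀ j, IsUpperSet ((![A, B, C] : Fin 3 → Set (Set ι)) j) := by
    intro j; fin_cases j <;> assumption
  have hBA : (esupp B ∩ esupp A).Nonempty := by rwa [inter_comm]
  have hCA : (esupp C ∩ esupp A).Nonempty := by rwa [inter_comm]
  have hCB : (esupp C ∩ esupp B).Nonempty := by rwa [inter_comm]
  have hpair : ∀ a b : Fin 3, a ≠ b →
      (esupp ((![A, B, C] : Fin 3 → Set (Set ι)) a) ∩ esupp ((![A, B, C] : Fin 3 → Set (Set ι)) b)).Nonempty := by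
    intro a b hab
    fin_cases a <;> fin_cases b <;> first | exact absurd rfl hab | assumption
  have hAne : A.Nonempty := by obtain ⟨i, hi⟩ := hAB; exact (nonempty_of_esupp_nonempty ⟨i, (mem_inter.1 hi).1⟩).1
  have hBne : B.Nonempty := by obtain ⟨i, hi⟩ := hAB; exact (nonempty_of_esupp_nonempty ⟨i, (mem_inter.1 hi).2⟩).1
  have hCne : C.Nonempty := by obtain ⟨i, hi⟩ := hAC; exact (nonempty_of_esupp_nonempty ⟨i, (mem_inter.1 hi).2⟩).1
  -- permuted forms of `hcommon`, `hpriv`, `hmin`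
  have hcACB : ∀ i, i ∈ esupp A → i ∈ esupp C → i ∉ esupp B := fun i hA' hC' hB' => hcommon i hA' hB' hC'
  have hcBAC : ∀ i, i ∈ esupp B → i ∈ esupp A → i ∉ esupp C := fun i hB' hA' => hcommon i hA' hB'
  have hcBCA : ∀ i, i ∈ esupp B → i ∈ esupp C → i ∉ esupp A := fun i hB' hC' hA' => hcommon i hA' hB' hC'
  have hcCAB : ∀ i, i ∈ esupp C → i ∈ esupp A → i ∉ esupp B := fun i hC' hA' hB' => hcommon i hA' hB' hC'
  have hcCBA : ∀ i, i ∈ esupp C → i ∈ esupp B → i ∉ esupp A := fun i hC' hB' hA' => hcommon i hA' hB' hC'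
  have hpA' : esupp A ⊆ esupp C ∪ esupp B := by rwa [union_comm]
  have hpB' : esupp B ⊆ esupp C ∪ esupp A := by rwa [union_comm]
  have hpC' : esupp C ⊆ esupp B ∪ esupp A := by rwa [union_comm]
  have up : ∀ (X : Set (Set ι)) (i : ι) (b : Bool), IsUpperSet X → IsUpperSet (secAt i b X) :=
    fun X i b h => isUpperSet_secAt i b h
  have memW : ∀ {i : ι} {P Q R : Finset ι}, i ∈ P ∪ Q ∪ R → i ∈ Q ∪ P ∪ R ∧ i ∈ P ∪ R ∪ Q ∧ i ∈ R ∪ P ∪ Q ∧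
      i ∈ Q ∪ R ∪ P ∧ i ∈ R ∪ Q ∪ P := by
    intro i P Q R h; simp only [mem_union] at h ⊢; tauto
  have hmBAC : ∀ i ∈ esupp B ∪ esupp A ∪ esupp C, ∀ b : Bool,
      SuppZeroFlag 3 ![secAt i b B, secAt i b A, secAt i b C] := fun i hi b =>
    (suppZeroFlag_three_swap12 (up A i b hA) (up B i b hB) (up C i b hC)).1 (hmin i (memW hi).1 b)
  have hmACB : ∀ i ∈ esupp A ∪ esupp C ∪ esupp B, ∀ b : Bool,
      SuppZeroFlag 3 ![secAt i b A, secAt i b C, secAt i b B] := fun i hi b =>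
    (suppZeroFlag_three_swap23 (up A i b hA) (up B i b hB) (up C i b hC)).1 (hmin i (memW hi).2.1 b)
  have hmCAB : ∀ i ∈ esupp C ∪ esupp A ∪ esupp B, ∀ b : Bool,
      SuppZeroFlag 3 ![secAt i b C, secAt i b A, secAt i b B] := fun i hi b =>
    (suppZeroFlag_three_swap12 (up A i b hA) (up C i b hC) (up B i b hB)).1 (hmACB i (memW hi).1 b)
  have hmBCA : ∀ i ∈ esupp B ∪ esupp C ∪ esupp A, ∀ b : Bool,
      SuppZeroFlag 3 ![secAt i b B, secAt i b C, secAt i b A] := fun i hi b =>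
    (suppZeroFlag_three_swap23 (up B i b hB) (up A i b hA) (up C i b hC)).1 (hmBAC i (memW hi).2.1 b)
  have hmCBA : ∀ i ∈ esupp C ∪ esupp B ∪ esupp A, ∀ b : Bool,
      SuppZeroFlag 3 ![secAt i b C, secAt i b B, secAt i b A] := fun i hi b =>
    (suppZeroFlag_three_swap12 (up B i b hB) (up C i b hC) (up A i b hA)).1 (hmBCA i (memW hi).1 b)
  by_cases hsat : (∃ f ∈ esupp A, secAt f true A = Set.univ) ∨ (∃ f ∈ esupp B, secAt f true B = Set.univ) ∨
      (∃ f ∈ esupp C, secAt f true C = Set.univ)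
  · -- THE TRIANGLE
    have hclassT : SahiHybrid.IsClassT fun i => esupp ((![A, B, C] : Fin 3 → Set (Set ι)) i) := by
      rintro i ⟨h0, h1, h2⟩
      exact hcommon i h0 h1 h2
    apply sahiE_three_pos_of_triangle hU hpair hclassT
    rcases hsat with ⟨f, hf, hs⟩ | ⟨f, hf, hs⟩ | ⟨f, hf, hs⟩
    · rcases mem_union.1 (hprivA hf) with hf' | hf'
      · obtain ⟨s, t, eA, eB, eC, qA, qB, qC⟩ :=
          triangle_of_saturation hA hB hC hAC hBC hprivA hprivB hprivC hcommon hmin hf hf' hs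
        have hfs : f ≠ s := fun h => hcommon f hf hf' (by rw [eC, h]; simp)
        have hft : f ≠ t := fun h => hcommon f hf hf' (by rw [eC, h]; simp)
        have hst : s ≠ t := fun h => hcommon s (by rw [eA]; simp) (by rw [eB, h]; simp) (by rw [eC]; simp)
        intro j; fin_cases j
        · exact ⟨f, s, hfs, qA, eA⟩
        · exact ⟨f, t, hft, qB, eB⟩
        · exact ⟨s, t, hst, qC, eC⟩
      · obtain ⟨s, t, eA, eC, eB, qA, qC, qB⟩ :=
          triangle_of_saturation hA hC hB hAB hCB hpA' hprivC hprivB hcACB hmACB hf hf' hs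
        have hfs : f ≠ s := fun h => hcACB f hf hf' (by rw [eB, h]; simp)
        have hft : f ≠ t := fun h => hcACB f hf hf' (by rw [eB, h]; simp)
        have hst : s ≠ t := fun h => hcACB s (by rw [eA]; simp) (by rw [eC, h]; simp) (by rw [eB]; simp)
        intro j; fin_cases j
        · exact ⟨f, s, hfs, qA, eA⟩
        · exact ⟨s, t, hst, qB, eB⟩
        · exact ⟨f, t, hft, qC, eC⟩
    · rcases mem_union.1 (hprivB hf) with hf' | hf'
      · obtain ⟨s, t, eB, eA, eC, qB, qA, qC⟩ :=
          triangle_of_saturation hB hA hC hBC hAC hprivB hprivA hpC' hcBAC hmBAC hf hf' hs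
        have hfs : f ≠ s := fun h => hcBAC f hf hf' (by rw [eC, h]; simp)
        have hft : f ≠ t := fun h => hcBAC f hf hf' (by rw [eC, h]; simp)
        have hst : s ≠ t := fun h => hcBAC s (by rw [eB]; simp) (by rw [eA, h]; simp) (by rw [eC]; simp)
        intro j; fin_cases j
        · exact ⟨f, t, hft, qA, eA⟩
        · exact ⟨f, s, hfs, qB, eB⟩
        · exact ⟨s, t, hst, qC, eC⟩
      · obtain ⟨s, t, eB, eC, eA, qB, qC, qA⟩ :=
          triangle_of_saturation hB hC hA hBA hCA hpB' hpC' hprivA hcBCA hmBCA hf hf' hs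
        have hfs : f ≠ s := fun h => hcBCA f hf hf' (by rw [eA, h]; simp)
        have hft : f ≠ t := fun h => hcBCA f hf hf' (by rw [eA, h]; simp)
        have hst : s ≠ t := fun h => hcBCA s (by rw [eB]; simp) (by rw [eC, h]; simp) (by rw [eA]; simp)
        intro j; fin_cases j
        · exact ⟨s, t, hst, qA, eA⟩
        · exact ⟨f, s, hfs, qB, eB⟩
        · exact ⟨f, t, hft, qC, eC⟩
    · rcases mem_union.1 (hprivC hf) with hf' | hf'
      · obtain ⟨s, t, eC, eA, eB, qC, qA, qB⟩ :=
          triangle_of_saturation hC hA hB hCB hAB hprivC hpA' hpB' hcCAB hmCAB hf hf' hs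
        have hfs : f ≠ s := fun h => hcCAB f hf hf' (by rw [eB, h]; simp)
        have hft : f ≠ t := fun h => hcCAB f hf hf' (by rw [eB, h]; simp)
        have hst : s ≠ t := fun h => hcCAB s (by rw [eC]; simp) (by rw [eA, h]; simp) (by rw [eB]; simp)
        intro j; fin_cases j
        · exact ⟨f, t, hft, qA, eA⟩
        · exact ⟨s, t, hst, qB, eB⟩
        · exact ⟨f, s, hfs, qC, eC⟩
      · obtain ⟨s, t, eC, eB, eA, qC, qB, qA⟩ :=
          triangle_of_saturation hC hB hA hCA hBA hpC' hpB' hpA' hcCBA hmCBA hf hf' hs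
        have hfs : f ≠ s := fun h => hcCBA f hf hf' (by rw [eA, h]; simp)
        have hft : f ≠ t := fun h => hcCBA f hf hf' (by rw [eA, h]; simp)
        have hst : s ≠ t := fun h => hcCBA s (by rw [eC]; simp) (by rw [eB, h]; simp) (by rw [eA]; simp)
        intro j; fin_cases j
        · exact ⟨s, t, hst, qA, eA⟩
        · exact ⟨f, t, hft, qB, eB⟩
        · exact ⟨f, s, hfs, qC, eC⟩
  · -- NO SATURATION: a pure event exists, and pure events are cylinders
    simp only [not_or, not_exists, not_and] at hsat
    obtain ⟨nsA, nsB, nsC⟩ := hsat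
    have hNSA : ∀ s ∈ esupp A, ({s} : Set ι) ∉ A := fun s hs h => nsA s hs ((secAt_true_eq_univ_iff' hA s).2 h)
    have hNSB : ∀ s ∈ esupp B, ({s} : Set ι) ∉ B := fun s hs h => nsB s hs ((secAt_true_eq_univ_iff' hB s).2 h)
    have hNSC : ∀ s ∈ esupp C, ({s} : Set ι) ∉ C := fun s hs h => nsC s hs ((secAt_true_eq_univ_iff' hC s).2 h)
    have hpure : (∀ f ∈ esupp A, secAt f false A = ∅) ∨ (∀ f ∈ esupp B, secAt f false B = ∅) ∨
        (∀ f ∈ esupp C, secAt f false C = ∅) := by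
      by_cases hN0AB : ∃ e ∈ esupp A ∩ esupp B, Set.univ \ {e} ∈ A ∧ Set.univ \ {e} ∈ B
      · obtain ⟨e, he, h1, h2⟩ := hN0AB
        exact Or.inr (Or.inr (lemma_L3 hA hB hC hAB hAC hBC hprivA hprivB hprivC hcommon hNSA hNSB hNSC hmin
          (mem_inter.1 he).1 (mem_inter.1 he).2 h1 h2))
      by_cases hN0AC : ∃ e ∈ esupp A ∩ esupp C, Set.univ \ {e} ∈ A ∧ Set.univ \ {e} ∈ C
      · obtain ⟨e, he, h1, h2⟩ := hN0AC
        exact Or.inr (Or.inl (lemma_L3 hA hC hB hAC hAB hCB hpA' hprivC hprivB hcACB hNSA hNSC hNSB hmACB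
          (mem_inter.1 he).1 (mem_inter.1 he).2 h1 h2))
      by_cases hN0BC : ∃ e ∈ esupp B ∩ esupp C, Set.univ \ {e} ∈ B ∧ Set.univ \ {e} ∈ C
      · obtain ⟨e, he, h1, h2⟩ := hN0BC
        exact Or.inl (lemma_L3 hB hC hA hBC hBA hCA hpB' hpC' hprivA hcBCA hNSB hNSC hNSA hmBCA
          (mem_inter.1 he).1 (mem_inter.1 he).2 h1 h2)
      -- every shared coordinate is mandatory for exactly one of its events
      have gtype : ∀ {X Y Z : Set (Set ι)}, IsUpperSet X → IsUpperSet Y → IsUpperSet Z →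
          X.Nonempty → Y.Nonempty → Z.Nonempty → (esupp X ∩ esupp Z).Nonempty →
          (∀ i, i ∈ esupp X → i ∈ esupp Y → i ∉ esupp Z) → (∀ i, i ∈ esupp X → i ∈ esupp Z → i ∉ esupp Y) →
          (∀ i ∈ esupp X ∪ esupp Y ∪ esupp Z, ∀ b : Bool, SuppZeroFlag 3 ![secAt i b X, secAt i b Y, secAt i b Z]) →
          (¬ ∃ e ∈ esupp X ∩ esupp Y, Set.univ \ {e} ∈ X ∧ Set.univ \ {e} ∈ Y) →
          ∀ f, f ∈ esupp X → f ∈ esupp Y → (secAt f false X = ∅ ↔ secAt f false Y ≠ ∅) := by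
        intro X Y Z hX hY hZ hXne hYne hZne hXZ hcXYZ hcXZY hm hN0 f hfX hfY
        constructor
        · intro hmX hmY
          obtain ⟨s, hs⟩ := hXZ
          have hsX := (mem_inter.1 hs).1
          have hsZ := (mem_inter.1 hs).2
          have hse : s ≠ f := fun h => hcXYZ f hfX hfY (h ▸ hsZ)
          exact lemma_L2 hX hY hZ hXne hYne hZne hse hfY (hcXYZ f hfX hfY) (hcXZY s hsX hsZ) hmX hmY
            (hm s (by simp [hsX]) true)
        · intro hmY
          by_contra hmX
          refine hN0 ⟨f, mem_inter.2 ⟨hfX, hfY⟩, ?_, ?_⟩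
          · by_contra h; exact hmX ((secAt_false_eq_empty_iff hX f).2 h)
          · by_contra h; exact hmY ((secAt_false_eq_empty_iff hY f).2 h)
      have hGAB := gtype hA hB hC hAne hBne hCne hAC hcommon hcACB hmin hN0AB
      have hGAC := gtype hA hC hB hAne hCne hBne hAB hcACB hcommon hmACB hN0AC
      have hGBC := gtype hB hC hA hBne hCne hAne hBA hcBCA hcBAC hmBCA hN0BC
      exact stepA hA hB hC hAne hBne hCne hAB hAC hBC hprivA hprivB hprivC hcommon (fun i hi => hmin i hi true)
        hGAB hGAC hGBC
    -- a pure event is a cylinder; cylinders settle (EQ-3)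
    refine ⟨halfParams ι, halfParams_mem_Ioo ι, ?_⟩
    rcases hpure with h | h | h
    · exact sahiE_three_pos_of_cylinder hU hpair 0 _ (eq_cylinder_of_pure hA hAne h) _ (halfParams_mem_Ioo ι)
    · exact sahiE_three_pos_of_cylinder hU hpair 1 _ (eq_cylinder_of_pure hB hBne h) _ (halfParams_mem_Ioo ι)
    · exact sahiE_three_pos_of_cylinder hU hpair 2 _ (eq_cylinder_of_pure hC hCne h) _ (halfParams_mem_Ioo ι)

/-! ### The theorem -/

/-- **(P3+) on the terminal class**: every terminal triple of increasing events (pairwise dependent, no common pivotal coordinate,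
all minors zero flags) has `E_3(μ_p) > 0` at some interior `p` — the tree's `SahiE3NonvanishingOfTerminal_holds` with the sign. [this work] -/
theorem exists_sahiE_three_pos_of_terminal {ι : Type} [Fintype ι] (U : Fin 3 → Set (Set ι)) (S : Finset ι)
    (hU : ∀ j, IsUpperSet (U j)) (hUS : ∀ j, DeterminedBy (U j) (↑S : Set ι)) (hT : TerminalTriple U S) :
    ∃ p : ι → unitInterval, (∀ e, (p e : ℝ) ∈ Set.Ioo (0 : ℝ) 1) ∧
      0 < sahiE (bernoulliWeight p) 3 (fun j => ind (U j)) := by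
  obtain ⟨hPD, hnc, hmin⟩ := hT
  have hT' : TerminalTriple U S := ⟨hPD, hnc, hmin⟩
  -- pairwise-intersecting essential supports
  have hdep : ∀ {X Y : Set (Set ι)}, IsUpperSet X → IsUpperSet Y → ¬ SuppZeroFlag 2 ![X, Y] →
      (esupp X ∩ esupp Y).Nonempty := by
    intro X Y hX hY h
    by_contra hne
    rw [Finset.not_nonempty_iff_eq_empty] at hne
    exact h ((suppZeroFlag_two_iff hX hY).2 (Finset.disjoint_iff_inter_eq_empty.2 hne))
  have e12 : (fun j : Fin 2 => U ((0 : Fin 3).succAbove j)) = ![U 1, U 2] := by funext j; fin_cases j <;> rfl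
  have e02 : (fun j : Fin 2 => U ((1 : Fin 3).succAbove j)) = ![U 0, U 2] := by funext j; fin_cases j <;> rfl
  have e01 : (fun j : Fin 2 => U ((2 : Fin 3).succAbove j)) = ![U 0, U 1] := by funext j; fin_cases j <;> rfl
  have h12 := hPD 0; rw [e12] at h12
  have h02 := hPD 1; rw [e02] at h02
  have h01 := hPD 2; rw [e01] at h01
  have hAB := hdep (hU 0) (hU 1) h01
  have hAC := hdep (hU 0) (hU 2) h02
  have hBC := hdep (hU 1) (hU 2) h12
  -- no common coordinate
  have hcommon : ∀ i, i ∈ esupp (U 0) → i ∈ esupp (U 1) → i ∉ esupp (U 2) := by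
    intro i h0 h1 h2
    refine hnc ⟨i, fun j => ?_⟩
    have hj : Affects (U j) i := by
      fin_cases j
      · exact mem_esupp.1 h0
      · exact mem_esupp.1 h1
      · exact mem_esupp.1 h2
    obtain ⟨ω, hω, hiω⟩ := hj
    exact ⟨ω, fun hi => hω (by rwa [Set.insert_eq_of_mem hi] at hiω), hω, hiω⟩
  -- all minors, in matrix form
  have hsec : ∀ (e : ι) (b : Bool), (fun j => secAt e b (U j)) = ![secAt e b (U 0), secAt e b (U 1), secAt e b (U 2)] := by
    intro e b; funext j; fin_cases j <;> rfl
  have hminW : ∀ i ∈ esupp (U 0) ∪ esupp (U 1) ∪ esupp (U 2), ∀ b : Bool,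
      SuppZeroFlag 3 ![secAt i b (U 0), secAt i b (U 1), secAt i b (U 2)] := by
    intro i hi b
    have hiS : i ∈ S := by
      simp only [mem_union] at hi
      rcases hi with (hi | hi) | hi
      · exact esupp_subset_of_determinedBy (hUS 0) hi
      · exact esupp_subset_of_determinedBy (hUS 1) hi
      · exact esupp_subset_of_determinedBy (hUS 2) hi
    have := hmin i hiS b
    rwa [hsec] at this
  -- no private coordinate (Lemma P, three slots)
  have hprivA : esupp (U 0) ⊆ esupp (U 1) ∪ esupp (U 2) := esupp_subset_union_of_terminal hU hUS hT'
  have up : ∀ (j : Fin 3) (i : ι) (b : Bool), IsUpperSet (secAt i b (U j)) := fun j i b => isUpperSet_secAt i b (hU j)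
  have hprivB : esupp (U 1) ⊆ esupp (U 0) ∪ esupp (U 2) := by
    intro e he
    by_contra hnot
    rw [mem_union, not_or] at hnot
    have heS : e ∈ S := esupp_subset_of_determinedBy (hUS 1) he
    have hmin' : ∀ b : Bool, SuppZeroFlag 3 ![secAt e b (U 1), U 0, U 2] := by
      intro b
      have h := hmin e heS b
      rw [hsec, secAt_eq_self_of_not_affects (hU 0) (fun h' => hnot.1 (mem_esupp.2 h')) b,
        secAt_eq_self_of_not_affects (hU 2) (fun h' => hnot.2 (mem_esupp.2 h')) b] at h
      exact (suppZeroFlag_three_swap12 (hU 0) (up 1 e b) (hU 2)).1 h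
    exact not_both_minors_zeroFlag (hU 1) (hU 0) (hU 2) (by rwa [inter_comm]) hBC hAC hnot.1 hnot.2
      (hmin' false) (hmin' true)
  have hprivC : esupp (U 2) ⊆ esupp (U 0) ∪ esupp (U 1) := by
    intro e he
    by_contra hnot
    rw [mem_union, not_or] at hnot
    have heS : e ∈ S := esupp_subset_of_determinedBy (hUS 2) he
    have hmin' : ∀ b : Bool, SuppZeroFlag 3 ![secAt e b (U 2), U 0, U 1] := by
      intro b
      have h := hmin e heS b
      rw [hsec, secAt_eq_self_of_not_affects (hU 0) (fun h' => hnot.1 (mem_esupp.2 h')) b,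
        secAt_eq_self_of_not_affects (hU 1) (fun h' => hnot.2 (mem_esupp.2 h')) b] at h
      exact (suppZeroFlag_three_swap12 (hU 0) (up 2 e b) (hU 1)).1
        ((suppZeroFlag_three_swap23 (hU 0) (hU 1) (up 2 e b)).1 h)
    exact not_both_minors_zeroFlag (hU 2) (hU 0) (hU 1) (by rwa [inter_comm]) (by rwa [inter_comm]) hAB hnot.1
      hnot.2 (hmin' false) (hmin' true)
  -- the core
  have hF : (fun j => ind (U j)) = fun j => ind ((![U 0, U 1, U 2] : Fin 3 → Set (Set ι)) j) := by
    funext j; fin_cases j <;> rfl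
  rw [hF]
  exact terminal_core_pos (hU 0) (hU 1) (hU 2) hAB hAC hBC hprivA hprivB hprivC hcommon hminW

end Summit.CriticalPhenomena.PercolationContinuityZ3.Theorems
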